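import Mathlib
import Literature.MathematicalPhysics.QuantumManyBody.BoseEinsteinCondensation
import Literature.MathematicalPhysics.QuantumManyBody.BoseGasThermodynamicLimitRuelle
import Literature.MathematicalPhysics.QuantumManyBody.BoseGasCatStates
import Literature.MathematicalPhysics.QuantumManyBody.OneParticleMarginals
import Literature.MathematicalPhysics.QuantumManyBody.MeanSelfDensity

/-!
# Fragmented (Fock) states of the interacting gas: energy windows are wall-limited

Solo-blind residency `solo-AtomisticToContinuum-blind`, session 3 (kernel part of the no-go
Proposition 11.1 of the working paper).

The definition `condensateNumber v N L = sup_δ inf_{E(Ψ) ≤ E₀ + δ} maxOccupation Ψ` certifies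
condensation through an **energy window**. This file proves, for the *interacting* gas and
arbitrary symmetric states, the structural upper bound behind the obstruction "energy windows
cannot see past one Dirichlet wall":

* `occupation_le_of_blockCounts` — if a symmetric normalised `Ψ` is supported on
  configurations that place exactly `cnt j` particles in each of finitely many pairwise disjoint
  measurable regions `U j` (covering the support), then for every normalised mode `φ` the
  occupation `⟨φ, γ_Ψ φ⟩` is at most `max_j cnt j`: the one-particle density matrix is
  block-diagonal, `γ_Ψ = ⊕_j γ_j` with `tr γ_j = cnt j`. The proof is Cauchy–Schwarz per block
  plus the observation that, for fixed positions of the other particles, at most one block can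
  carry the last particle.
* `occupation_merge_le`, `maxOccupation_merge_le` — Ruelle's merged state
  `Ψ₁.merge Ψ₂` of `N₁` bosons in `U₁` and `N₂` bosons in a disjoint `U₂` has
  `maxOccupation ≤ max N₁ N₂`, whatever `Ψ₁, Ψ₂` are (no product structure, no positivity, no
  free-gas input).

The energy-window consequences (a window containing the two-half-box energy certifies at most
`max N₁ N₂` condensed particles) are in `SoloBlindFragmentedWindow`.
-/

noncomputable section

open MeasureTheory Filter Set
open scoped ENNReal NNReal ComplexConjugate

namespace Summit.AtomisticToContinuum.BoseEinsteinCondensation.Theorems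

open Literature.MathematicalPhysics.QuantumManyBody.BoseGas

/-! ### Block counts -/

section BlockCounts

variable {n m : ℕ}

/-- Peeling the first particle off a block count. -/
theorem blockCount_vecCons (U : Set Space) (x : Space) (Y : Config n) :
    ∑ p : Fin (n + 1), U.indicator (fun _ => (1 : ℝ≥0∞)) ((Matrix.vecCons x Y : Config (n + 1)) p)
      = U.indicator (fun _ => (1 : ℝ≥0∞)) x
        + ∑ q : Fin n, U.indicator (fun _ => (1 : ℝ≥0∞)) (Y q) := by
  rw [Fin.sum_univ_succ]
  simp

/-- **Block-diagonal one-particle density matrix.** A symmetric normalised `Ψ` on `(ℝ³)^{n+1}`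
whose support places exactly `cnt j` particles in each of the pairwise disjoint measurable
regions `U j` (which cover the support) has `⟨φ, γ_Ψ φ⟩ ≤ K` for every normalised mode `φ`
as soon as `cnt j ≤ K` for all `j`. -/
theorem occupation_le_of_blockCounts {Ψ : Config (n + 1) → ℂ} (hΨc : Continuous Ψ)
    (hsymm : ∀ (σ : Equiv.Perm (Fin (n + 1))) (X : Config (n + 1)), Ψ (X ∘ σ) = Ψ X)
    (hnorm : ∫⁻ X, (‖Ψ X‖₊ : ℝ≥0∞) ^ 2 = 1)
    (U : Fin m → Set Space) (hUm : ∀ j, MeasurableSet (U j))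
    (hU : ∀ j l, j ≠ l → ∀ x, x ∈ U j → x ∉ U l) (cnt : Fin m → ℕ)
    (hcnt : ∀ X, Ψ X ≠ 0 → ∀ j,
      ∑ p : Fin (n + 1), (U j).indicator (fun _ => (1 : ℝ≥0∞)) (X p) = cnt j)
    (hcov : ∀ X, Ψ X ≠ 0 → ∀ p, ∃ j, X p ∈ U j)
    {φ : Space → ℂ} (hφ : AEStronglyMeasurable φ volume)
    (hφ1 : ∫⁻ x, (‖φ x‖₊ : ℝ≥0∞) ^ 2 = 1) {K : ℕ} (hK : ∀ j, cnt j ≤ K) :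
    occupation (n + 1) φ Ψ ≤ K := by
  classical
  -- the integrand of `⟨φ, γ φ⟩` for fixed positions `Y` of the other particles
  set f : Config n → Space → ℂ := fun Y x => conj (φ x) * Ψ (Matrix.vecCons x Y) with hf
  -- its block pieces
  set a : Fin m → Config n → ℂ := fun j Y => ∫ x, (U j).indicator (f Y) x with ha
  -- the `φ`-mass of a block
  set Φ : Fin m → ℝ≥0∞ :=
    fun j => ∫⁻ x, (U j).indicator (fun x => (‖φ x‖₊ : ℝ≥0∞) ^ 2) x with hΦ
  -- `|Ψ|²` restricted to "particle 0 in block j"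
  set G : Fin m → Config (n + 1) → ℝ≥0∞ :=
    fun j X => (U j).indicator (fun _ => (1 : ℝ≥0∞)) (X 0) * (‖Ψ X‖₊ : ℝ≥0∞) ^ 2 with hG
  have hGm : ∀ j, Measurable (G j) := fun j =>
    ((measurable_const.indicator (hUm j)).comp (measurable_pi_apply 0)).mul
      (hΨc.measurable.nnnorm.coe_nnreal_ennreal.pow_const _)
  -- Step 1: pointwise in `Y`, `|∫ f_Y|² ≤ ∑_j Φ_j ∫_x G_j(x, Y)`.
  have hstep : ∀ Y : Config n,
      (‖∫ x, f Y x‖₊ : ℝ≥0∞) ^ 2 ≤ ∑ j, Φ j * ∫⁻ x, G j (Matrix.vecCons x Y) := by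
    intro Y
    -- a nonzero block piece has a witness in its block
    have hwit : ∀ j, a j Y ≠ 0 → ∃ x ∈ U j, Ψ (Matrix.vecCons x Y) ≠ 0 := by
      intro j hj
      by_contra hcon
      push Not at hcon
      apply hj
      have h0 : (U j).indicator (f Y) = fun _ => 0 := by
        funext x
        by_cases hx : x ∈ U j
        · rw [Set.indicator_of_mem hx, hf]
          simp [hcon x hx]
        · exact Set.indicator_of_notMem hx _
      rw [ha]
      simp only [h0, integral_zero]
    -- two different blocks cannot both carry particle `0` (block counts)
    have hpair : ∀ j l, j ≠ l → a j Y = 0 ∨ a l Y = 0 := by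
      intro j l hjl
      by_contra hcon
      push Not at hcon
      obtain ⟨x, hxU, hx⟩ := hwit j hcon.1
      obtain ⟨x', hx'U, hx'⟩ := hwit l hcon.2
      have h1 := hcnt _ hx j
      have h2 := hcnt _ hx' j
      rw [blockCount_vecCons, Set.indicator_of_mem hxU] at h1
      rw [blockCount_vecCons, Set.indicator_of_notMem (hU l j hjl.symm x' hx'U), zero_add] at h2
      rw [h2] at h1
      have h3 : ((1 + cnt j : ℕ) : ℝ≥0∞) = ((cnt j : ℕ) : ℝ≥0∞) := by
        push_cast
        exact h1
      have h4 := Nat.cast_injective h3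
      omega
    -- Cauchy–Schwarz on each block
    have hCS : ∀ j, (‖a j Y‖₊ : ℝ≥0∞) ^ 2 ≤ Φ j * ∫⁻ x, G j (Matrix.vecCons x Y) := by
      intro j
      have hrw : (U j).indicator (f Y) = fun x =>
          (U j).indicator (fun x => Ψ (Matrix.vecCons x Y)) x * conj ((U j).indicator φ x) := by
        funext x
        by_cases hx : x ∈ U j
        · simp only [Set.indicator_of_mem hx, hf]
          ring
        · simp only [Set.indicator_of_notMem hx, zero_mul]
      have hmeas1 : AEMeasurable ((U j).indicator fun x => Ψ (Matrix.vecCons x Y)) volume :=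
        ((hΨc.measurable.comp (measurable_vecCons_left Y)).indicator (hUm j)).aemeasurable
      have hmeas2 : AEMeasurable ((U j).indicator φ) volume :=
        hφ.aemeasurable.indicator (hUm j)
      rw [ha]
      dsimp only
      rw [hrw]
      calc (‖∫ x, (U j).indicator (fun x => Ψ (Matrix.vecCons x Y)) x
              * conj ((U j).indicator φ x)‖₊ : ℝ≥0∞) ^ 2
          ≤ (∫⁻ x, (‖(U j).indicator (fun x => Ψ (Matrix.vecCons x Y)) x‖₊ : ℝ≥0∞) ^ 2)
              * ∫⁻ x, (‖(U j).indicator φ x‖₊ : ℝ≥0∞) ^ 2 :=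
            sq_nnnorm_integral_mul_conj_le hmeas1 hmeas2
        _ = (∫⁻ x, G j (Matrix.vecCons x Y)) * Φ j := by
            congr 1
            · refine lintegral_congr fun x => ?_
              rw [hG]
              dsimp only
              rw [Matrix.cons_val_zero]
              by_cases hx : x ∈ U j
              · simp [Set.indicator_of_mem hx]
              · simp [Set.indicator_of_notMem hx]
            · refine lintegral_congr fun x => ?_
              by_cases hx : x ∈ U j
              · simp [Set.indicator_of_mem hx]
              · simp [Set.indicator_of_notMem hx]
        _ = Φ j * ∫⁻ x, G j (Matrix.vecCons x Y) := mul_comm _ _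
    by_cases hint : Integrable (f Y) volume
    · -- split the integral into its block pieces
      have hpt : ∀ x, f Y x = ∑ j, (U j).indicator (f Y) x := by
        intro x
        by_cases hx0 : Ψ (Matrix.vecCons x Y) = 0
        · have hfx : f Y x = 0 := by
            rw [hf]
            simp [hx0]
          rw [hfx]
          symm
          refine Finset.sum_eq_zero fun j _ => ?_
          by_cases hx : x ∈ U j
          · rw [Set.indicator_of_mem hx, hfx]
          · exact Set.indicator_of_notMem hx _
        · obtain ⟨j₀, hj₀⟩ := hcov _ hx0 0
          rw [Matrix.cons_val_zero] at hj₀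
          rw [Finset.sum_eq_single j₀
              (fun l _ hl => Set.indicator_of_notMem (hU j₀ l (Ne.symm hl) x hj₀) _)
              (fun h => absurd (Finset.mem_univ _) h), Set.indicator_of_mem hj₀]
      have hsum : ∫ x, f Y x = ∑ j, a j Y := by
        have : (fun x => f Y x) = fun x => ∑ j, (U j).indicator (f Y) x := funext hpt
        rw [this, integral_finsetSum _ fun j _ => hint.indicator (hUm j)]
      rw [hsum, ennnorm_sum_sq_of_pairwise (fun j => a j Y) hpair]
      exact Finset.sum_le_sum fun j _ => hCS j
    · rw [integral_undef hint]
      simp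
  -- Step 2: the block masses of `|Ψ|²` integrate to the block counts (symmetry).
  have hmass : ∀ j, (n + 1 : ℝ≥0∞) * ∫⁻ X, G j X = cnt j := by
    intro j
    -- each particle contributes the same mass as particle `0`
    have hp : ∀ p : Fin (n + 1),
        ∫⁻ X, (U j).indicator (fun _ => (1 : ℝ≥0∞)) (X p) * (‖Ψ X‖₊ : ℝ≥0∞) ^ 2
          = ∫⁻ X, G j X := by
      intro p
      rw [← lintegral_comp_perm (Equiv.swap 0 p) (G j)]
      refine lintegral_congr fun X => ?_
      rw [hG]
      dsimp only
      rw [Function.comp_apply, Equiv.swap_apply_left, hsymm]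
    have hsum : (n + 1 : ℝ≥0∞) * ∫⁻ X, G j X
        = ∑ p : Fin (n + 1), ∫⁻ X, (U j).indicator (fun _ => (1 : ℝ≥0∞)) (X p)
            * (‖Ψ X‖₊ : ℝ≥0∞) ^ 2 := by
      rw [Finset.sum_congr rfl fun p _ => hp p, Finset.sum_const, Finset.card_univ,
        Fintype.card_fin, nsmul_eq_mul]
      push_cast
      ring
    rw [hsum, ← lintegral_finsetSum' (s := Finset.univ)
      (f := fun p X => (U j).indicator (fun _ => (1 : ℝ≥0∞)) (X p) * (‖Ψ X‖₊ : ℝ≥0∞) ^ 2)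
      (fun p _ => (Measurable.mul ((measurable_const.indicator (hUm j)).comp
        (measurable_pi_apply p)) (hΨc.measurable.nnnorm.coe_nnreal_ennreal.pow_const _)
          ).aemeasurable)]
    have hpt : ∀ X, ∑ p : Fin (n + 1), (U j).indicator (fun _ => (1 : ℝ≥0∞)) (X p)
        * (‖Ψ X‖₊ : ℝ≥0∞) ^ 2 = (cnt j : ℝ≥0∞) * (‖Ψ X‖₊ : ℝ≥0∞) ^ 2 := by
      intro X
      rw [← Finset.sum_mul]
      by_cases hX : Ψ X = 0
      · simp [hX]
      · rw [hcnt X hX j]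
    simp_rw [hpt]
    rw [lintegral_const_mul _ (hΨc.measurable.nnnorm.coe_nnreal_ennreal.pow_const _), hnorm,
      mul_one]
  -- Step 3: the block masses of `φ` sum to at most `1`.
  have hΦsum : ∑ j, Φ j ≤ 1 := by
    calc ∑ j, Φ j = ∫⁻ x, ∑ j, (U j).indicator (fun x => (‖φ x‖₊ : ℝ≥0∞) ^ 2) x := by
          rw [hΦ]
          exact (lintegral_finsetSum' _ fun j _ =>
            ((hφ.aemeasurable.nnnorm.coe_nnreal_ennreal.pow_const _).indicator (hUm j))).symm
      _ ≤ ∫⁻ x, (‖φ x‖₊ : ℝ≥0∞) ^ 2 :=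
          lintegral_mono fun x => sum_indicator_le_of_pairwise U hU _ x
      _ = 1 := hφ1
  -- Step 4: assemble.
  have hocc : occupation (n + 1) φ Ψ = (n + 1 : ℝ≥0∞) * ∫⁻ Y, (‖∫ x, f Y x‖₊ : ℝ≥0∞) ^ 2 := by
    simp [occupation, hf]
  calc occupation (n + 1) φ Ψ
      = (n + 1 : ℝ≥0∞) * ∫⁻ Y, (‖∫ x, f Y x‖₊ : ℝ≥0∞) ^ 2 := hocc
    _ ≤ (n + 1 : ℝ≥0∞) * ∫⁻ Y, ∑ j, Φ j * ∫⁻ x, G j (Matrix.vecCons x Y) := by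
        exact mul_le_mul_right (lintegral_mono fun Y => hstep Y) _
    _ = ∑ j, Φ j * ((n + 1 : ℝ≥0∞) * ∫⁻ X, G j X) := by
        rw [lintegral_finsetSum' _ fun j _ =>
          ((measurable_lintegral_vecCons (hGm j)).const_mul _).aemeasurable, Finset.mul_sum]
        refine Finset.sum_congr rfl fun j _ => ?_
        rw [lintegral_const_mul _ (measurable_lintegral_vecCons (hGm j)),
          ← lintegral_eq_lintegral_lintegral_vecCons (hGm j)]
        ring
    _ = ∑ j, Φ j * (cnt j : ℝ≥0∞) := by
        simp_rw [hmass]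
    _ ≤ ∑ j, Φ j * (K : ℝ≥0∞) := by
        gcongr with j
        exact_mod_cast hK j
    _ = (∑ j, Φ j) * K := (Finset.sum_mul _ _ _).symm
    _ ≤ 1 * K := by gcongr
    _ = K := one_mul _

/-- `occupation_le_of_blockCounts` for an arbitrary particle number. -/
theorem occupation_le_of_blockCounts' {N : ℕ} {Ψ : Config N → ℂ} (hΨc : Continuous Ψ)
    (hsymm : ∀ (σ : Equiv.Perm (Fin N)) (X : Config N), Ψ (X ∘ σ) = Ψ X)
    (hnorm : ∫⁻ X, (‖Ψ X‖₊ : ℝ≥0∞) ^ 2 = 1)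
    (U : Fin m → Set Space) (hUm : ∀ j, MeasurableSet (U j))
    (hU : ∀ j l, j ≠ l → ∀ x, x ∈ U j → x ∉ U l) (cnt : Fin m → ℕ)
    (hcnt : ∀ X, Ψ X ≠ 0 → ∀ j,
      ∑ p : Fin N, (U j).indicator (fun _ => (1 : ℝ≥0∞)) (X p) = cnt j)
    (hcov : ∀ X, Ψ X ≠ 0 → ∀ p, ∃ j, X p ∈ U j)
    {φ : Space → ℂ} (hφ : AEStronglyMeasurable φ volume)
    (hφ1 : ∫⁻ x, (‖φ x‖₊ : ℝ≥0∞) ^ 2 = 1) {K : ℕ} (hK : ∀ j, cnt j ≤ K) :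
    occupation N φ Ψ ≤ K := by
  cases N with
  | zero => simp [occupation]
  | succ n =>
    exact occupation_le_of_blockCounts hΨc hsymm hnorm U hUm hU cnt hcnt hcov hφ hφ1 hK

end BlockCounts

/-! ### Ruelle's merged states are fragmented -/

section Merge

variable {N₁ N₂ : ℕ} {U₁ U₂ : Set Space}

/-- A configuration at which the merged state does not vanish admits an admissible relabelling:
`N₁` of its particles lie in `U₁` and the other `N₂` in `U₂`. -/
theorem permAdm_exists_of_merge_psi_ne_zero (Ψ₁ : SupportedState N₁ U₁)
    (Ψ₂ : SupportedState N₂ U₂) (hdisj : Disjoint U₁ U₂) {X : Config (N₁ + N₂)}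
    (hX : (Ψ₁.merge Ψ₂ hdisj).ψ X ≠ 0) :
    ∃ σ : Equiv.Perm (Fin (N₁ + N₂)), PermAdm N₁ N₂ U₁ U₂ σ X := by
  have h1 : symSum Ψ₁ Ψ₂ X ≠ 0 := by
    intro h0
    apply hX
    change ((mergeScale N₁ N₂ : ℝ) : ℂ) * symSum Ψ₁ Ψ₂ X = 0
    rw [h0, mul_zero]
  obtain ⟨σ, -, hσ⟩ := Finset.exists_ne_zero_of_sum_ne_zero h1
  by_contra hcon
  push Not at hcon
  exact hσ (permProd_eq_zero_of_not_permAdm Ψ₁ Ψ₂ (hcon σ)).1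

/-- Block counts of the merged state: `N₁` particles in `U₁`. -/
theorem blockCount_fst_of_permAdm (hdisj : Disjoint U₁ U₂) {X : Config (N₁ + N₂)}
    {σ : Equiv.Perm (Fin (N₁ + N₂))} (hσ : PermAdm N₁ N₂ U₁ U₂ σ X) :
    ∑ p : Fin (N₁ + N₂), U₁.indicator (fun _ => (1 : ℝ≥0∞)) (X p) = N₁ := by
  rw [← Equiv.sum_comp σ (fun p => U₁.indicator (fun _ => (1 : ℝ≥0∞)) (X p)), Fin.sum_univ_add]
  rw [Finset.sum_congr rfl fun i _ => Set.indicator_of_mem (hσ.1 i) _,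
    Finset.sum_congr rfl fun j _ =>
      Set.indicator_of_notMem (Set.disjoint_right.1 hdisj (hσ.2 j)) _]
  simp

/-- Block counts of the merged state: `N₂` particles in `U₂`. -/
theorem blockCount_snd_of_permAdm (hdisj : Disjoint U₁ U₂) {X : Config (N₁ + N₂)}
    {σ : Equiv.Perm (Fin (N₁ + N₂))} (hσ : PermAdm N₁ N₂ U₁ U₂ σ X) :
    ∑ p : Fin (N₁ + N₂), U₂.indicator (fun _ => (1 : ℝ≥0∞)) (X p) = N₂ := by
  rw [← Equiv.sum_comp σ (fun p => U₂.indicator (fun _ => (1 : ℝ≥0∞)) (X p)), Fin.sum_univ_add]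
  rw [Finset.sum_congr rfl fun i _ =>
      Set.indicator_of_notMem (Set.disjoint_left.1 hdisj (hσ.1 i)) _,
    Finset.sum_congr rfl fun j _ => Set.indicator_of_mem (hσ.2 j) _]
  simp

/-- **Merged states are fragmented.** For `Ψ₁` supported in `U₁^{N₁}` and `Ψ₂` in `U₂^{N₂}`
with `U₁, U₂` disjoint and measurable, every normalised mode has occupation at most
`max N₁ N₂` in Ruelle's merged state `Ψ₁.merge Ψ₂`. -/
theorem occupation_merge_le (Ψ₁ : SupportedState N₁ U₁) (Ψ₂ : SupportedState N₂ U₂)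
    (hdisj : Disjoint U₁ U₂) (hU₁ : MeasurableSet U₁) (hU₂ : MeasurableSet U₂)
    {φ : Space → ℂ} (hφ : AEStronglyMeasurable φ volume)
    (hφ1 : ∫⁻ x, (‖φ x‖₊ : ℝ≥0∞) ^ 2 = 1) :
    occupation (N₁ + N₂) φ (Ψ₁.merge Ψ₂ hdisj).ψ ≤ ((max N₁ N₂ : ℕ) : ℝ≥0∞) := by
  set Ψ := Ψ₁.merge Ψ₂ hdisj with hΨ
  refine occupation_le_of_blockCounts' Ψ.contDiff.continuous Ψ.symm Ψ.norm_eq ![U₁, U₂]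
    (fun j => by fin_cases j <;> simpa) ?_ ![N₁, N₂] ?_ ?_ hφ hφ1 (K := max N₁ N₂)
    (fun j => by fin_cases j <;> simp)
  · intro j l hjl x hxj hxl
    fin_cases j <;> fin_cases l
    · exact hjl rfl
    · exact Set.disjoint_left.1 hdisj (by simpa using hxj) (by simpa using hxl)
    · exact Set.disjoint_left.1 hdisj (by simpa using hxl) (by simpa using hxj)
    · exact hjl rfl
  · intro X hX j
    obtain ⟨σ, hσ⟩ := permAdm_exists_of_merge_psi_ne_zero Ψ₁ Ψ₂ hdisj hX
    fin_cases j
    · simpa using blockCount_fst_of_permAdm hdisj hσ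
    · simpa using blockCount_snd_of_permAdm hdisj hσ
  · intro X hX p
    by_contra hcon
    push Not at hcon
    apply hX
    refine Ψ.eq_zero X ⟨p, ?_⟩
    rintro (h | h)
    · exact hcon 0 (by simpa using h)
    · exact hcon 1 (by simpa using h)

/-- **Merged states are fragmented** (`maxOccupation` form). -/
theorem maxOccupation_merge_le (Ψ₁ : SupportedState N₁ U₁) (Ψ₂ : SupportedState N₂ U₂)
    (hdisj : Disjoint U₁ U₂) (hU₁ : MeasurableSet U₁) (hU₂ : MeasurableSet U₂) :
    maxOccupation (N₁ + N₂) (Ψ₁.merge Ψ₂ hdisj).ψ ≤ ((max N₁ N₂ : ℕ) : ℝ≥0∞) :=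
  iSup₂_le fun _ hφ => occupation_merge_le Ψ₁ Ψ₂ hdisj hU₁ hU₂ hφ.1 hφ.2

end Merge

end Summit.AtomisticToContinuum.BoseEinsteinCondensation.Theorems
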